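import Literature.Probability.Percolation.KhSThreeDisorderBoundaryValues
import Literature.Probability.Percolation.TriMarkedDomainRotate
import HarnessLib

/-!
# Khristoforov–Smirnov eq. (4) at `k = 3`, loop side, EVERY arc: `H_{a+2}(z) = 0` for `z` on the arc `A_a`

Topic `Literature/Probability/Percolation`; three-disorder lineage. The frame-`A₀` boundary-value law of
`KhSThreeDisorderBoundaryValues.lean` (`hobs_two_eq_zero_of_stretch_zero`: on the stretch `A₀`, `H₂(z) = 0`) transported to the arcs
`A₁`, `A₂` by the cyclic symmetry of the marks (`TriMarkedDomain.rotate`, `TriMarkedDomainRotate.lean`: `D.rotate.stretch 0 = D.stretch 1`,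
`Hobs D.rotate v i j = Hobs D v i (j + 1)`): for a boundary bond `side v i = s(g, o)` with `(g, o) ∈ D.stretch a`, `H_{a+2}(z) = 0` — the
corner opposite to the arc is never linked to `z` (Khristoforov–Smirnov's «on `∂_jΩ` the pattern `[z ↔ u_j]` is absent», all `j`).

## References
* M. Khristoforov, S. Smirnov, *Percolation and O(1) loop model*, arXiv:2111.15612 (2021), §2 eq. (4) (arXiv v1 p. 5).
-/

open Finset

namespace Literature.Probability.Percolation.MarkedLoops

open Literature.Probability.Percolation Literature.Probability.LatticeModels
open Literature.Probability.Percolation.FivePoint (side)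
open TriMarkedDomain

/-- a dart of the `j`-th stretch has stretch index `j`. [folklore] [cite: KhristoforovSmirnov2021, §2 eq. (4) (arXiv v1 p. 5)] -/
theorem stretchIdx₃_of_mem_stretch (D : TriMarkedDomain 3) {j : Fin 3} {d : Site 2 × Site 2} (hd : d ∈ D.stretch j) :
    D.stretchIdx₃ (D.dpos d) = j := by
  unfold stretch at hd
  obtain ⟨n, hn, rfl⟩ := Finset.mem_image.1 hd
  rw [Finset.mem_Ico] at hn
  have hnl : n < #(triBdryDarts D.verts) := lt_of_lt_of_le hn.2 (D.nextPos_le_bdryLen j)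
  rw [D.dpos_iter, Nat.mod_eq_of_lt hnl]
  exact D.stretchIdx_eq_of_mem₃ hn.1 hn.2

/-- ★ **`H_{a+2}(z) = 0` on the arc `A_a`** (every `a : Fin 3`): at an edge of `H_G` whose bond is a boundary dart of the `a`-th stretch,
read at a face with three `H_G`-sides, the link pattern to the opposite corner is absent. [cite: KhristoforovSmirnov2021, §2 eq. (4) (arXiv v1 p. 5)] -/
theorem hobs_opposite_eq_zero (D : TriMarkedDomain 3) {v : HexVertex} (hv : AllSides D v) {i : Fin 3} {g o : Site 2}
    (he : side v i = s(g, o)) (hg : g ∈ D.verts) (ho : o ∉ D.verts) {a : Fin 3} (hd : (g, o) ∈ D.stretch a) :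
    Hobs D v i (a + 2) = 0 := by
  have h3 : ∀ a' : Fin 3, a' = 0 ∨ a' = 1 ∨ a' = 2 := by decide
  rcases h3 a with rfl | rfl | rfl
  · exact hobs_two_eq_zero_of_stretch_zero hv he hg ho (stretchIdx₃_of_mem_stretch D hd)
  · -- A₁ of D is A₀ of D.rotate; H₂ of D.rotate is H₀ of D
    have hd' : (g, o) ∈ D.rotate.stretch 0 := by rw [rotate_stretch]; exact hd
    have h := hobs_two_eq_zero_of_stretch_zero (D := D.rotate) ((rotate_allSides D v).2 hv) he hg ho
      (stretchIdx₃_of_mem_stretch D.rotate hd')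
    rw [rotate_hobs] at h
    exact h
  · -- A₂ of D is A₀ of D.rotate.rotate; H₂ there is H₁ of D
    have hd' : (g, o) ∈ D.rotate.rotate.stretch 0 := by rw [rotate_stretch, rotate_stretch]; exact hd
    have h := hobs_two_eq_zero_of_stretch_zero (D := D.rotate.rotate)
      ((rotate_allSides D.rotate v).2 ((rotate_allSides D v).2 hv)) he hg ho (stretchIdx₃_of_mem_stretch D.rotate.rotate hd')
    rw [rotate_hobs, rotate_hobs] at h
    exact h

/-- … hence on `A_a` the two remaining patterns carry all the mass: `H_a(z) + H_{a+1}(z) = 1`. [cite: KhristoforovSmirnov2021, §2 eq. (4) (arXiv v1 p. 5)] -/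
theorem hobs_add_hobs_succ_eq_one (D : TriMarkedDomain 3) {v : HexVertex} (hv : AllSides D v) {i : Fin 3} {g o : Site 2}
    (he : side v i = s(g, o)) (hg : g ∈ D.verts) (ho : o ∉ D.verts) {a : Fin 3} (hd : (g, o) ∈ D.stretch a) :
    Hobs D v i a + Hobs D v i (a + 1) = 1 := by
  have h := sum_hobs_eq_one D hv i
  have h0 := hobs_opposite_eq_zero D hv he hg ho hd
  rw [Fin.sum_univ_three] at h
  have h3 : ∀ a' : Fin 3, a' = 0 ∨ a' = 1 ∨ a' = 2 := by decide
  rcases h3 a with rfl | rfl | rfl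
  · have e : (0 : Fin 3) + 2 = 2 := rfl
    rw [e] at h0; rw [h0, add_zero] at h; exact h
  · have e : (1 : Fin 3) + 2 = 0 := rfl
    have e1 : (1 : Fin 3) + 1 = 2 := rfl
    rw [e] at h0; rw [h0, zero_add] at h; rw [e1]; exact h
  · have e : (2 : Fin 3) + 2 = 1 := rfl
    have e1 : (2 : Fin 3) + 1 = 0 := rfl
    rw [e] at h0; rw [h0, add_zero] at h; rw [e1, add_comm]; exact h

end Literature.Probability.Percolation.MarkedLoops
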